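import Mathlib
import Summits.Schanuel.Schanuel.Theorems.AclSubsetLogFreeCore.Negative.ExpAclDefinability

/-!
# Crux `AclSubsetLogFreeCore` — refuted strengthening: the branches of `log 2` are NOT `∅`-indiscernible in `ℂ_exp`

Negative knowledge for the route `RigidCore` (crux stmt-Schanuel-0968 and its planned instance
table "BI₂ ⇒ π ⊥ log 2"): the slogan "`ℂ_exp` does not know which logarithm is real", read as
**`∅`-indiscernibility of the branches `ln 2 + 2πik`** (every `∅`-definable set contains all
branches of `log 2` or none), is FALSE.  By KMO's Kummer trick `√2 = e^u + e^{-u}` with `8u` a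
kernel generator, `√2` is pointwise `∅`-definable (`sqrtTwoSet = {√2}`), hence the PARITY of the
branch is `∅`-definable: `branchParitySet = {z | e^z = 2 ∧ ∃ w (2w = z ∧ e^w = √2)}` contains
`ln 2` and not `ln 2 + 2πi` (`e^{(ln 2)/2 + πi} = −√2`).  Consequences recorded by the route
reviewers: instance statements of type BI₂ must be made modulo `4πi` (index-2 Kummer
obstruction: `[ℚ^{ab}(2^{1/m}) : ℚ^{ab}] = m / gcd(m, 2)`); the crux (A) itself is untouched (the
parity classes are infinite, no branch becomes `∅`-algebraic).

## References

* [KirbyMacintyreOnshuus2012] J. Kirby, A. Macintyre, A. Onshuus, *The algebraic numbers definable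
  in various exponential fields*, J. Inst. Math. Jussieu 11 (2012), arXiv:1101.4224, Theorem 1 and
  §2.7 (real abelian numbers, e.g. `√2 = 2cos(π/4)`, are pointwise `∅`-definable).
* [Nathanson2022] M. B. Nathanson, *Exponential automorphisms of ℂ*, arXiv:2209.01027, Thm. 4
  (Mycielski's question: automorphisms move `ln 2` only mod `2πi`; sharpened here to mod `4πi`).
-/

noncomputable section

open FirstOrder FirstOrder.Language Set
open Literature.ModelTheory.ExponentialFields

namespace Summit.Schanuel.Schanuel.Theorems.AclSubsetLogFreeCore.Negative

variable {α : Type*} {A : Set ℂ}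

/-- `√2` is pointwise `∅`-definable (KMO's Kummer trick): `y = e^u + e^{-u}` with `8u` a kernel
generator (`u = ±πi/4`). -/
def sqrtTwoSet : Set ℂ :=
  {y | ∃ t : ℂ, t ∈ kerGenSet ∧ ∃ u : ℂ,
    ((u + u) + (u + u)) + ((u + u) + (u + u)) = t ∧ y = Complex.exp u + Complex.exp (-u)}

/-- `e^{±πi/4} + e^{∓πi/4} = √2`. [folklore] -/
theorem exp_add_exp_neg_pi_div_four (u : ℂ) (hu : u = ↑(Real.pi / 4) * Complex.I ∨
    u = -(↑(Real.pi / 4) * Complex.I)) :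
    Complex.exp u + Complex.exp (-u) = (Real.sqrt 2 : ℂ) := by
  have key : Complex.exp (↑(Real.pi / 4) * Complex.I) + Complex.exp (-(↑(Real.pi / 4) * Complex.I)) =
      (Real.sqrt 2 : ℂ) := by
    have h := Complex.two_cos (↑(Real.pi / 4) : ℂ)
    rw [neg_mul] at h
    rw [← h, ← Complex.ofReal_cos, Real.cos_pi_div_four]
    push_cast; ring
  rcases hu with rfl | rfl
  · exact key
  · rw [neg_neg, add_comm]; exact key

/-- `sqrtTwoSet = {√2}`. [cite: KirbyMacintyreOnshuus2012, §2.7] -/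
theorem mem_sqrtTwoSet_iff {y : ℂ} : y ∈ sqrtTwoSet ↔ y = (Real.sqrt 2 : ℂ) := by
  constructor
  · rintro ⟨t, ht, u, hu, rfl⟩
    refine exp_add_exp_neg_pi_div_four u ?_
    rcases mem_kerGenSet_iff.1 ht with rfl | rfl
    · left; push_cast; linear_combination hu / 8
    · right; push_cast; linear_combination hu / 8
  · rintro rfl
    refine ⟨2 * Real.pi * Complex.I, mem_kerGenSet_iff.2 (Or.inl rfl), ↑(Real.pi / 4) * Complex.I,
      by push_cast; ring, (exp_add_exp_neg_pi_div_four _ (Or.inl rfl)).symm⟩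

/-- `g v = √2` (through the Kummer formula) is a definable condition. [cite: KirbyMacintyreOnshuus2012, §2.7] -/
theorem definable_mem_sqrtTwoSet {g : (α → ℂ) → ℂ} (hg : A.DefinableFun Language.expRing g) :
    A.Definable Language.expRing {v : α → ℂ | g v ∈ sqrtTwoSet} := by
  simp only [sqrtTwoSet, Set.mem_setOf_eq]
  refine definable_setOf_exists_params (definable_setOf_and_params ?_ ?_)
  · exact definable_mem_kerGenSet (definableFun_proj_params _)
  · refine definable_setOf_exists_params (definable_setOf_and_params ?_ ?_)
    · have hu : A.DefinableFun Language.expRing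
          (fun w : (α ⊕ Unit) ⊕ Unit → ℂ => w (Sum.inr ())) := definableFun_proj_params _
      have h2 := definableFun_add' hu hu
      have h4 := definableFun_add' h2 h2
      exact definable_setOf_eq_params (definableFun_add' h4 h4) (definableFun_proj_params _)
    · exact definable_setOf_eq_params (definableFun_reindex hg (Sum.inl ∘ Sum.inl))
        (definableFun_add' (definableFun_cexp (definableFun_proj_params _))
          (definableFun_cexp (definableFun_neg' (definableFun_proj_params _))))

/-- The **branch-parity set** `e^z = 2 ∧ ∃ w (2w = z ∧ e^w = √2)`: an `∅`-definable subset of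
the branches `{ln 2 + 2πik}` containing exactly the even ones. -/
def branchParitySet : Set ℂ :=
  {z | Complex.exp z = 2 ∧ ∃ w : ℂ, w + w = z ∧ ∃ y : ℂ, y ∈ sqrtTwoSet ∧ Complex.exp w = y}

/-- The branch-parity set is `∅`-definable. [cite: KirbyMacintyreOnshuus2012, §2.7] -/
theorem definable₁_branchParitySet :
    Set.Definable₁ (∅ : Set ℂ) Language.expRing branchParitySet := by
  unfold Set.Definable₁
  simp only [branchParitySet, Set.mem_setOf_eq]
  have h2 : (∅ : Set ℂ).DefinableFun Language.expRing (fun _ : Fin 1 → ℂ => (2 : ℂ)) := by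
    simpa using definableFun_natCast' (A := (∅ : Set ℂ)) (α := Fin 1) 2
  refine definable_setOf_and_params ?_ ?_
  · exact definable_setOf_eq_params (definableFun_cexp (definableFun_proj_params _)) h2
  · refine definable_setOf_exists_params (definable_setOf_and_params ?_ ?_)
    · exact definable_setOf_eq_params (definableFun_add' (definableFun_proj_params _)
        (definableFun_proj_params _)) (definableFun_proj_params _)
    · refine definable_setOf_exists_params (definable_setOf_and_params ?_ ?_)
      · exact definable_mem_sqrtTwoSet (definableFun_proj_params _)
      · exact definable_setOf_eq_params (definableFun_cexp (definableFun_proj_params _))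
          (definableFun_proj_params _)

/-- `e^{ln 2} = 2` in `ℂ`. [folklore] -/
theorem exp_log_two : Complex.exp (Real.log 2 : ℂ) = 2 := by
  rw [← Complex.ofReal_exp, Real.exp_log two_pos]; norm_num

/-- `e^{(ln 2)/2} = √2` in `ℂ`. [folklore] -/
theorem exp_half_log_two : Complex.exp ((Real.log 2 : ℂ) / 2) = (Real.sqrt 2 : ℂ) := by
  have : ((Real.log 2 : ℂ) / 2) = ((Real.log 2 / 2 : ℝ) : ℂ) := by push_cast; ring
  rw [this, ← Complex.ofReal_exp, ← Real.log_sqrt (by norm_num : (0 : ℝ) ≤ 2),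
    Real.exp_log (Real.sqrt_pos.2 two_pos)]

/-- The principal branch `ln 2` is in the parity set. [folklore] -/
theorem log_two_mem_branchParitySet : (Real.log 2 : ℂ) ∈ branchParitySet :=
  ⟨exp_log_two, (Real.log 2 : ℂ) / 2, by ring, _, mem_sqrtTwoSet_iff.2 rfl, exp_half_log_two⟩

/-- The branch `ln 2 + 2πi` is not in the parity set (`e^{(ln 2)/2 + πi} = −√2`). [folklore] -/
theorem log_two_add_two_pi_I_not_mem_branchParitySet :
    (Real.log 2 : ℂ) + 2 * Real.pi * Complex.I ∉ branchParitySet := by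
  rintro ⟨-, w, hw, y, hy, hwy⟩
  rw [mem_sqrtTwoSet_iff.1 hy] at hwy
  have hw' : w = (Real.log 2 : ℂ) / 2 + Real.pi * Complex.I := by linear_combination hw / 2
  rw [hw', Complex.exp_add, exp_half_log_two, Complex.exp_pi_mul_I] at hwy
  have h0 : (Real.sqrt 2 : ℂ) = 0 := by linear_combination -hwy / 2
  have : Real.sqrt 2 = 0 := by exact_mod_cast h0
  simp at this

/-- **REFUTED STRENGTHENING (branch indiscernibility).** It is NOT the case that every
`∅`-definable subset of `ℂ_exp` contains, with a logarithm of `2`, all its `2πiℤ`-translates: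
the parity of the branch is `∅`-definable (Kummer obstruction of index 2).  BI₂-type instance
lemmas of the route must be stated modulo `4πi`. [cite: KirbyMacintyreOnshuus2012, Theorem 1] -/
theorem not_branchIndiscernibility :
    ¬ (∀ s : Set ℂ, Set.Definable₁ (∅ : Set ℂ) Language.expRing s →
        ∀ z : ℂ, Complex.exp z = 2 → ∀ k : ℤ, (z ∈ s ↔ z + k * (2 * Real.pi * Complex.I) ∈ s)) :=
  fun h => by
  have h1 := (h _ definable₁_branchParitySet _ exp_log_two 1).1 log_two_mem_branchParitySet
  simp only [Int.cast_one, one_mul] at h1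
  exact log_two_add_two_pi_I_not_mem_branchParitySet h1

end Summit.Schanuel.Schanuel.Theorems.AclSubsetLogFreeCore.Negative
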